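import Mathlib
import Literature.Computability.AlgebraicComplexity.GroupTheoreticMatMul

/-!
# `RectangularThmB` (crux stmt-MatrixMultiplication-10597, route ThinBlockAlpha):
# the chart STPP theorem (Cohn–Kleinberg–Szegedy–Umans 2005, Def. 36 / Thm. 37) over the tree's `IsSTPP`

Negative-side support file for the refutation of `ThinBlockAlpha.RectangularThmB` (null-offset chart over
`ℤ/9`); `sorry`-free, imports only the tree's `IsSTPP` (CKSU 2005 Def. 5.1, additive form).

Conventions (all inlined, no `Prop`-valued definitions).  A *chart* assigns to each symbol `x : Γ` three
finite sets `A x, B x, C x ⊆ H₀`; the coordinate pattern `(x, y, z)` (symbols of rows `i, j, k`) is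
*solvable* if some `s ∈ A z, s' ∈ A x, t ∈ B x, t' ∈ B y, u ∈ C y, u' ∈ C z` satisfy
`(s' - s) + (t' - t) + (u' - u) = 0` — the index pattern of the tree's `IsSTPP`; a family of rows
`row : Fin L → Fin n → Γ` is a *local chart-USP* if every ordered index triple not all equal has an
unsolvable coordinate; a symbol has the *TPP* if its diagonal pattern is solvable only trivially.

* `isSTPP_pi_of_localChartUSP` — a local chart-USP over a chart with per-symbol TPP generates an STPP
  family of product sets `∏_c A (row i c), ∏_c B (row i c), ∏_c C (row i c)` in `H₀ⁿ` (CKSU Thm. 37,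
  the chart version of Thm. 33).
-/

set_option linter.dupNamespace false

namespace Summit.MatrixMultiplication.MatrixMultiplication.Theorems.RectangularThmB.Negative

open Literature.Computability.AlgebraicComplexity

/-- **CKSU 2005 Thm. 37 in the tree's conventions**: a local chart-USP over a chart with per-symbol TPP
generates an STPP family of product sets in `H₀ⁿ`.  Proof: project the STPP relation to each coordinate
(`Fintype.mem_piFinset`, `congrFun`): every coordinate pattern is solvable, so the three indices coincide
by the local chart-USP property, and then the per-symbol TPP identifies the elements coordinatewise.
[cite: CohnKleinbergSzegedyUmans2005, Thm. 37 (p. 11)] -/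
theorem isSTPP_pi_of_localChartUSP : ∀ (H₀ Γ : Type) [AddCommGroup H₀] [DecidableEq H₀]
    (A B C : Γ → Finset H₀),
    (∀ x, ∀ s ∈ A x, ∀ s' ∈ A x, ∀ t ∈ B x, ∀ t' ∈ B x, ∀ u ∈ C x, ∀ u' ∈ C x,
      (s' - s) + (t' - t) + (u' - u) = 0 → s = s' ∧ t = t' ∧ u = u') →
    ∀ (n L : ℕ) (row : Fin L → Fin n → Γ),
    (∀ i j k : Fin L, (i ≠ j ∨ j ≠ k) → ∃ c : Fin n,
      ¬ ∃ s ∈ A (row k c), ∃ s' ∈ A (row i c), ∃ t ∈ B (row i c), ∃ t' ∈ B (row j c),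
        ∃ u ∈ C (row j c), ∃ u' ∈ C (row k c), (s' - s) + (t' - t) + (u' - u) = 0) →
      IsSTPP (fun i => Fintype.piFinset fun c => A (row i c))
        (fun i => Fintype.piFinset fun c => B (row i c))
        (fun i => Fintype.piFinset fun c => C (row i c)) := by
  intro H₀ Γ _ _ A B C hTPP n L row hUSP i j k s hs s' hs' t ht t' ht' u hu u' hu' hrel
  simp only [Fintype.mem_piFinset] at hs hs' ht ht' hu hu'
  -- the relation, coordinate by coordinate
  have hc : ∀ c, (s' c - s c) + (t' c - t c) + (u' c - u c) = 0 := fun c => by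
    have h := congrFun hrel c
    simpa using h
  -- every coordinate pattern is solvable
  have hsolv : ∀ c, ∃ s₀ ∈ A (row k c), ∃ s₀' ∈ A (row i c), ∃ t₀ ∈ B (row i c), ∃ t₀' ∈ B (row j c),
      ∃ u₀ ∈ C (row j c), ∃ u₀' ∈ C (row k c), (s₀' - s₀) + (t₀' - t₀) + (u₀' - u₀) = 0 := fun c =>
    ⟨s c, hs c, s' c, hs' c, t c, ht c, t' c, ht' c, u c, hu c, u' c, hu' c, hc c⟩
  -- hence the indices coincide
  have hijk : i = j ∧ j = k := by
    by_contra hne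
    have hne' : i ≠ j ∨ j ≠ k := by tauto
    obtain ⟨c, hc'⟩ := hUSP i j k hne'
    exact hc' (hsolv c)
  obtain ⟨rfl, rfl⟩ := hijk
  -- and the per-symbol TPP finishes
  refine ⟨rfl, rfl, ?_, ?_, ?_⟩
  · funext c
    exact (hTPP (row i c) (s c) (hs c) (s' c) (hs' c) (t c) (ht c) (t' c) (ht' c) (u c) (hu c)
      (u' c) (hu' c) (hc c)).1
  · funext c
    exact (hTPP (row i c) (s c) (hs c) (s' c) (hs' c) (t c) (ht c) (t' c) (ht' c) (u c) (hu c)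
      (u' c) (hu' c) (hc c)).2.1
  · funext c
    exact (hTPP (row i c) (s c) (hs c) (s' c) (hs' c) (t c) (ht c) (t' c) (ht' c) (u c) (hu c)
      (u' c) (hu' c) (hc c)).2.2

end Summit.MatrixMultiplication.MatrixMultiplication.Theorems.RectangularThmB.Negative
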